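import Literature.MathematicalPhysics.QuantumFieldTheory.Balaban1983to89.B9Eq326ConjugatedDeltaATowerTwoBackgroundsCloseness
import Literature.MathematicalPhysics.QuantumFieldTheory.Balaban1983to89.B9Eq3101ConjugationLettersTwoBackgroundsAdjoint
import Literature.MathematicalPhysics.QuantumFieldTheory.Balaban1983to89.B9Eq373TransporterLipschitzLetters

/-!
# `Balaban1983to89.B9Eq326ConjugatedDeltaATowerTwoBackgroundsFirstOrder` — T. Bałaban, *Propagators for lattice gauge theories in a background field*,
# Commun. Math. Phys. **99** (1985) 389–434 [Balaban1985BackgroundPropagators] (3.70)–(3.73) pp. 404–405, (3.49) p. 399, (3.26) p. 395, Thm 3.4 p. 400, Thm 3.11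
# p. 416: **THE TWO-BACKGROUND DIFFERENCE OF THE CONJUGATED `k`-LEVEL BOND PROPAGATOR AT THE CLOSENESS WINDOW WITH ALL FOUR FIRST-ORDER CONJUGATED LETTERS
# DISCHARGED — `δ₁ = 4e^{‖κ‖ℓη}M_φM_φ′(d√d)δ` (curl ∕ cocurl), `δ₂ = 2e^{‖κ‖ℓη}M_φM_φ′√d·δ` (divergence ∕ gradient), `e₁ = 8√dM_φM_φ′δ`, `e₂ = 2M_φM_φ′δ√d`, all from
# `‖U(b) − V(b)‖ ≤ δη`, NO window on `κ`, NO `η`** — the consolidation of this lineage's I-4 ∕ I-5 ∕ I-6 ∕ I-9: what stays displayed are (CDT)'s own letters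
# (twice) and the three non-first-order sockets `δ_R` (`R_k`), `δ_Q` (`Q_k`), `δ_K` (`Δ′`) with the unconjugated `e_R`, `e_Q`

statement-level skeleton of published theorems with citation tags; proofs where landed; nothing here is a claim about the Yang–Mills mass gap

CITATION HEADER (lean-in-tree rule).  Audit cell `pub-balaban`, sub-cell `t4`, BINDER row NE9; filed by NE9 formalisation-swarm LEAF PROVER 01
(`b2b-balaban-t4-ne9-formalise-leaf-01`, gen 88) under the fallback offer O-leaf01-g88-2 (t4-ne9-idea-1 g151 N52 road (α); cell journal 2026-08-25).  Imports this
lineage's `B9Eq326ConjugatedDeltaATowerTwoBackgroundsCloseness` (the END at the closeness window), `B9Eq3101ConjugationLettersTwoBackgroundsAdjoint` (through it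
`…TwoBackgrounds`: the four «conjugate the difference» letters) and the NE9 owner's `B9Eq373TransporterLipschitzLetters` (`norm_adTransportW_sub_adTransportW_le`,
`norm_adTransportW_inv_sub_adTransportW_inv_le`: the fibre transporters of two `U1`-valued fields and of their inverses are `2M_φM_φ′‖U(b) − V(b)‖`-close).
Sources READ first-hand in the held text layer (`paper:balaban1985-cmp99-background-propagators`, journal page = PDF page + 388): pp. 404–405 (3.70)–(3.73), p. 399
(3.49), p. 395 (3.26), p. 400 Thm 3.4, p. 416 Thm 3.11.  The conjugation is the ROUTE's Combes–Thomas substitute; nothing of print's rate or radius is asserted.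

WHAT IS PROVED (sorry-free; proof lane — no `def`; [folklore] composition BY NAME).
* **`norm_conjG1k_sub_conjG1k_le_firstOrder`** — `…Closeness.norm_conjG1k_sub_conjG1k_le_of_closeness` with `tB₁ := norm_mulOp_covCurlL2K_sub_covCurlL2K_le`,
  `tB₁′ := norm_mulOp_covCoCurlL2K_sub_covCoCurlL2K_le`, `tB₂ := norm_mulOp_covDivL2K_sub_covDivL2K_le`, `tB₂′ := norm_mulOp_covDerivL2K_sub_covDerivL2K_le` at the
  transporter differences `2M_φM_φ′δη` (`V` against `U`, inverses for the divergence ∕ cocurl sides), `θ := ℓη`, `‖η⁻¹‖·η = 1`, `d ≤ d√d`.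
MODEL ∕ HONEST SCOPE.  As the parents; first order; the three remaining conjugated sockets are NOT first-order multiplication letters (`R_k` is non-local; `Q_k`
is semi-local — the OWNER chain's (QC)∕(TQ) pattern; `Δ′` is ne9-leaf-04 g81's announced file) and stay displayed with `e_R`, `e_Q`; no rate, no window
evaluated; the read-out to block decay is the consumer's line.  NOT NE9 (cell pub-balaban: NE9 NOT PRINTED ∕ NOT PROVED; «NE9 ⇐ the named binders»; row WALLED
ON A MODEL (O-NE9-1; #5 UNRULED); spine PROVED 0∕9; rung (B)+1 on a finite T⁴ — NOT infinite volume, NOT mass gap, NOT BetaPertH, NOT Clay).  HONEST DEPENDENCY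
(cell line): continuum YM on T⁴ ⇐ BetaPertH ∧ nine spine estimates (0/9 proved); BetaPertH ⇐ (D1) ∧ (D4) ∧ CAP+tail; G-an2-4 gates asym, D1 and NE2/3/4.  NEW
file; nothing modified.  Net new unproved facts: 0.
-/

noncomputable section

open scoped InnerProductSpace ComplexConjugate BigOperators

namespace Literature.MathematicalPhysics.QuantumFieldTheory.Balaban1983to89.B9Eq326ConjugatedDeltaATowerTwoBackgroundsFirstOrder

open B4Sect5Torus (TSite)
open B9SectCLatticeCarrier (Bond bpos btgt)
open B9Eq311L2Pairing (WL2)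
open B7Prop1Explicit (U1)
open B9Eq315QTower (towerP)
open B9Eq315QTorus (perCfg cornerSite)
open B7Prop1Explicit (Wcx boxVec)
open B11Eq103H1Complex (SiteL2K BondL2K covDerivL2K covDivL2K)
open B9Eq310HessianOperator (adTransportW PlaqL2K covCurlL2K covCoCurlL2K curvOp)
open B9Eq326OperatorTower (laplaceAk RofUk G1k QkW)
open B9Eq326ConjugatedDeltaATowerTwoBackgroundsCloseness (norm_conjG1k_sub_conjG1k_le_of_closeness)
open B9Eq3101ConjugationLettersTwoBackgrounds (norm_mulOp_covCurlL2K_sub_covCurlL2K_le norm_mulOp_covDivL2K_sub_covDivL2K_le)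
open B9Eq3101ConjugationLettersTwoBackgroundsAdjoint (norm_mulOp_covCoCurlL2K_sub_covCoCurlL2K_le norm_mulOp_covDerivL2K_sub_covDerivL2K_le)
open B9Eq373TransporterLipschitzLetters (norm_adTransportW_inv_sub_adTransportW_inv_le)

variable {d : ℕ} (L : ℕ) [NeZero L] (m : Fin d → ℕ) [∀ i, NeZero (m i)] (n : ℕ)
  {𝔸 : Type*} [NormedRing 𝔸] [StarRing 𝔸] [NormedAlgebra ℂ 𝔸] [StarModule ℂ 𝔸] [CompleteSpace 𝔸] [NormOneClass 𝔸]
  {W : Type*} [NormedAddCommGroup W] [InnerProductSpace ℂ W] [FiniteDimensional ℂ W] (φ : W ≃ₗ[ℂ] 𝔸) {Mφ Mφ' : ℝ}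
  (hφ : ∀ w, ‖φ w‖ ≤ Mφ * ‖w‖) (hφ' : ∀ X, ‖φ.symm X‖ ≤ Mφ' * ‖X‖) (hMφ : 0 ≤ Mφ) (hMφ' : 0 ≤ Mφ')
  {c₀ : ℝ} [Fact (0 < c₀)] {c₁ : ℝ} [Fact (0 < c₁)] {η : ℝ} (hη : 0 < η)
  (U V : Bond d (towerP L m (n + 1)) → 𝔸ˣ) (hU : ∀ b, U b ∈ U1 𝔸) (hV : ∀ b, V b ∈ U1 𝔸)
  (hRSU : ∀ (b : Bond d (towerP L m (n + 1))) (v u : W), ⟪adTransportW φ U b v, u⟫_ℂ = ⟪v, adTransportW φ (fun b => (U b)⁻¹) b u⟫_ℂ)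
  (hRSV : ∀ (b : Bond d (towerP L m (n + 1))) (v u : W), ⟪adTransportW φ V b v, u⟫_ℂ = ⟪v, adTransportW φ (fun b => (V b)⁻¹) b u⟫_ℂ)
  (τ : 𝔸 →ₗ[ℂ] ℂ) (hL : 1 ≤ L) (α : ℕ → ℝ) (hα1 : ∀ j, α j ≤ 1 / 64)
  (hU1U : ∀ (j : ℕ) (x : B7Prop1Explicit.Site d) (κ : Fin d), perCfg (towerP L m (j + 1)) (B9Eq315QTower.UlevOf L m (n + 1) U j) x κ ∈ U1 𝔸)
  (hregU : ∀ (j : ℕ) (y : TSite d (towerP L m j)) (κ : Fin d) (r : Fin d → Fin L),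
    ‖((Wcx L (perCfg (towerP L m (j + 1)) (B9Eq315QTower.UlevOf L m (n + 1) U j)) (cornerSite L y) κ (boxVec L r) : 𝔸ˣ) : 𝔸) - 1‖ ≤ α j)
  (hU1V : ∀ (j : ℕ) (x : B7Prop1Explicit.Site d) (κ : Fin d), perCfg (towerP L m (j + 1)) (B9Eq315QTower.UlevOf L m (n + 1) V j) x κ ∈ U1 𝔸)
  (hregV : ∀ (j : ℕ) (y : TSite d (towerP L m j)) (κ : Fin d) (r : Fin d → Fin L),
    ‖((Wcx L (perCfg (towerP L m (j + 1)) (B9Eq315QTower.UlevOf L m (n + 1) V j)) (cornerSite L y) κ (boxVec L r) : 𝔸ˣ) : 𝔸) - 1‖ ≤ α j)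
  (a : ℝ)
  {κ : ℂ} {χ : TSite d (towerP L m (n + 1)) → ℝ}
  {S Sinv : BondL2K ℂ d (towerP L m (n + 1)) c₀ W →ₗ[ℂ] BondL2K ℂ d (towerP L m (n + 1)) c₀ W}
  (hS : ∀ (g : BondL2K ℂ d (towerP L m (n + 1)) c₀ W) (b : Bond d (towerP L m (n + 1))),
    WL2.equiv ℂ (fun _ : Bond d (towerP L m (n + 1)) => c₀) W (S g) b =
      Complex.exp (κ * (χ (bpos b) : ℂ)) • WL2.equiv ℂ (fun _ : Bond d (towerP L m (n + 1)) => c₀) W g b)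
  (hSinv : ∀ (g : BondL2K ℂ d (towerP L m (n + 1)) c₀ W) (b : Bond d (towerP L m (n + 1))),
    WL2.equiv ℂ (fun _ : Bond d (towerP L m (n + 1)) => c₀) W (Sinv g) b =
      Complex.exp (-(κ * (χ (bpos b) : ℂ))) • WL2.equiv ℂ (fun _ : Bond d (towerP L m (n + 1)) => c₀) W g b)
  {SP SPinv : PlaqL2K ℂ d (towerP L m (n + 1)) c₀ W →ₗ[ℂ] PlaqL2K ℂ d (towerP L m (n + 1)) c₀ W}
  (hSP : ∀ (g : PlaqL2K ℂ d (towerP L m (n + 1)) c₀ W) (p : B9SectCLatticeCarrier.Plaq d (towerP L m (n + 1))),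
    WL2.equiv ℂ (fun _ : B9SectCLatticeCarrier.Plaq d (towerP L m (n + 1)) => c₀) W (SP g) p =
      Complex.exp (κ * (χ p.1 : ℂ)) • WL2.equiv ℂ (fun _ : B9SectCLatticeCarrier.Plaq d (towerP L m (n + 1)) => c₀) W g p)
  (hSPinv : ∀ (g : PlaqL2K ℂ d (towerP L m (n + 1)) c₀ W) (p : B9SectCLatticeCarrier.Plaq d (towerP L m (n + 1))),
    WL2.equiv ℂ (fun _ : B9SectCLatticeCarrier.Plaq d (towerP L m (n + 1)) => c₀) W (SPinv g) p =
      Complex.exp (-(κ * (χ p.1 : ℂ))) • WL2.equiv ℂ (fun _ : B9SectCLatticeCarrier.Plaq d (towerP L m (n + 1)) => c₀) W g p)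
  {SS SSinv : SiteL2K ℂ d (towerP L m (n + 1)) c₀ W →ₗ[ℂ] SiteL2K ℂ d (towerP L m (n + 1)) c₀ W}
  (hSS : ∀ (g : SiteL2K ℂ d (towerP L m (n + 1)) c₀ W) (x : TSite d (towerP L m (n + 1))),
    WL2.equiv ℂ (fun _ : TSite d (towerP L m (n + 1)) => c₀) W (SS g) x =
      Complex.exp (κ * (χ x : ℂ)) • WL2.equiv ℂ (fun _ : TSite d (towerP L m (n + 1)) => c₀) W g x)
  (hSSinv : ∀ (g : SiteL2K ℂ d (towerP L m (n + 1)) c₀ W) (x : TSite d (towerP L m (n + 1))),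
    WL2.equiv ℂ (fun _ : TSite d (towerP L m (n + 1)) => c₀) W (SSinv g) x =
      Complex.exp (-(κ * (χ x : ℂ))) • WL2.equiv ℂ (fun _ : TSite d (towerP L m (n + 1)) => c₀) W g x)

include hφ hφ' hMφ hMφ' hη hU hV hRSU hRSV hS hSinv hSP hSPinv hSS hSSinv in
/-- **THE SAME WITH THE FOUR FIRST-ORDER CONJUGATED LETTERS DISCHARGED TOO** («conjugate the difference», `B9Eq3101ConjugationLettersTwoBackgrounds(Adjoint)`):
under the bond closeness `‖U(b) − V(b)‖ ≤ δη` the curl ∕ cocurl letters are `δ₁ := 4e^{‖κ‖ℓη}M_φM_φ′·(d√d)·δ` (the cocurl constant, which dominates the curl's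
`4e^{‖κ‖ℓη}M_φM_φ′·d·δ` since `d ≤ d√d`) and the divergence ∕ gradient letters are `δ₂ := 2e^{‖κ‖ℓη}M_φM_φ′·√d·δ` — transporter differences
`‖Ad U(b) − Ad V(b)‖, ‖Ad U(b)⁻¹ − Ad V(b)⁻¹‖ ≤ 2M_φM_φ′·δη` by `B9Eq373TransporterLipschitzLetters`, the `η⁻¹` of the scalar against the `η` of the
closeness (`‖η⁻¹‖·η = 1`), NO window on `κ`.  What stays displayed: (CDT)'s letters (twice), the conjugated `δ_R` (`R_k`, non-local), `δ_Q` (`Q_k`),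
`δ_K` (`Δ′`; ne9-leaf-04's announced `B9Eq369CurvFormConjugationTwoBackgrounds`) and the unconjugated `e_R`, `e_Q`. [folklore]
[cite: Balaban1985BackgroundPropagators, (3.70)–(3.73) pp.404–405, (3.49) p.399, (3.26) p.395, Thm 3.4 p.400, Thm 3.11 p.416] -/
theorem norm_conjG1k_sub_conjG1k_le_firstOrder (ha : 0 ≤ a)
    (hposU : ∀ x : BondL2K ℂ d (towerP L m (n + 1)) c₀ W, x ≠ 0 → 0 < RCLike.re ⟪x, laplaceAk L m n φ η U hL α hα1 hU1U hregU τ (c₀ := c₀) (c₁ := c₁) a x⟫_ℂ)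
    (hposV : ∀ x : BondL2K ℂ d (towerP L m (n + 1)) c₀ W, x ≠ 0 → 0 < RCLike.re ⟪x, laplaceAk L m n φ η V hL α hα1 hU1V hregV τ (c₀ := c₀) (c₁ := c₁) a x⟫_ℂ)
    {γ β βK pK ℓ ρ CP : ℝ} (hγ : 0 < γ) (hβ : 0 ≤ β) (hℓ : 0 ≤ ℓ) (hρ : 0 ≤ ρ) (hρ8 : ρ ≤ 1 / 8) (hCP : 0 ≤ CP)
    (hcoerU : ∀ f : BondL2K ℂ d (towerP L m (n + 1)) c₀ W, γ * ‖f‖ ^ 2 ≤ RCLike.re ⟪f, laplaceAk L m n φ η U hL α hα1 hU1U hregU τ (c₀ := c₀) (c₁ := c₁) a f⟫_ℂ)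
    (hcoerV : ∀ f : BondL2K ℂ d (towerP L m (n + 1)) c₀ W, γ * ‖f‖ ^ 2 ≤ RCLike.re ⟪f, laplaceAk L m n φ η V hL α hα1 hU1V hregV τ (c₀ := c₀) (c₁ := c₁) a f⟫_ℂ)
    (hKreU : ∀ f : BondL2K ℂ d (towerP L m (n + 1)) c₀ W, -(pK * ‖f‖ ^ 2) ≤ RCLike.re ⟪f, curvOp φ τ η U f⟫_ℂ)
    (hKreV : ∀ f : BondL2K ℂ d (towerP L m (n + 1)) c₀ W, -(pK * ‖f‖ ^ 2) ≤ RCLike.re ⟪f, curvOp φ τ η V f⟫_ℂ)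
    (hχ : ∀ b : Bond d (towerP L m (n + 1)), |χ (bpos b) - χ (btgt b)| ≤ ℓ * η) (hwin : ‖κ‖ * ℓ * η ≤ 1)
    (hβCC : 4 * ‖κ‖ * ℓ * (Mφ * Mφ') * (d * Real.sqrt d) ≤ β) (hβC : 4 * ‖κ‖ * ℓ * (Mφ * Mφ') * d ≤ β)
    (hβD : 2 * ‖κ‖ * ℓ * (Mφ * Mφ') * Real.sqrt d ≤ β)
    (QkU QkV : BondL2K ℂ d (towerP L m (n + 1)) c₀ W →ₗ[ℂ] BondL2K ℂ d m c₁ W) (QkU' QkV' : BondL2K ℂ d m c₁ W →ₗ[ℂ] BondL2K ℂ d (towerP L m (n + 1)) c₀ W)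
    (hQfacU : ∀ f, S (LinearMap.adjoint (QkW L m n φ U hL α hα1 hU1U hregU (c₀ := c₀) (c₁ := c₁)) (((a : ℝ) : ℂ) • (QkW L m n φ U hL α hα1 hU1U hregU (c₀ := c₀) (c₁ := c₁)) (Sinv f))) = ((a : ℝ) : ℂ) • QkU' (QkU f))
    (hQfacV : ∀ f, S (LinearMap.adjoint (QkW L m n φ V hL α hα1 hU1V hregV (c₀ := c₀) (c₁ := c₁)) (((a : ℝ) : ℂ) • (QkW L m n φ V hL α hα1 hU1V hregV (c₀ := c₀) (c₁ := c₁)) (Sinv f))) = ((a : ℝ) : ℂ) • QkV' (QkV f))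
    (dQU : ∀ f, ‖QkU f - (QkW L m n φ U hL α hα1 hU1U hregU (c₀ := c₀) (c₁ := c₁)) f‖ ≤ β * ‖f‖)
    (dQU' : ∀ g, ‖QkU' g - LinearMap.adjoint (QkW L m n φ U hL α hα1 hU1U hregU (c₀ := c₀) (c₁ := c₁)) g‖ ≤ β * ‖g‖)
    (dQV : ∀ f, ‖QkV f - (QkW L m n φ V hL α hα1 hU1V hregV (c₀ := c₀) (c₁ := c₁)) f‖ ≤ β * ‖f‖)
    (dQV' : ∀ g, ‖QkV' g - LinearMap.adjoint (QkW L m n φ V hL α hα1 hU1V hregV (c₀ := c₀) (c₁ := c₁)) g‖ ≤ β * ‖g‖)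
    (dKU : ∀ f, ‖(S ∘ₗ curvOp φ τ η U ∘ₗ Sinv) f - curvOp φ τ η U f‖ ≤ βK * ‖f‖)
    (dKV : ∀ f, ‖(S ∘ₗ curvOp φ τ η V ∘ₗ Sinv) f - curvOp φ τ η V f‖ ≤ βK * ‖f‖)
    (dRU : ∀ s, ‖(SS ∘ₗ RofUk L m n φ η U (c₀ := c₀) ∘ₗ SSinv) s - RofUk L m n φ η U (c₀ := c₀) s‖ ≤ ρ * ‖s‖)
    (dRV : ∀ s, ‖(SS ∘ₗ RofUk L m n φ η V (c₀ := c₀) ∘ₗ SSinv) s - RofUk L m n φ η V (c₀ := c₀) s‖ ≤ ρ * ‖s‖)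
    (hPU : ∀ f, ‖covDivL2K ℂ c₀ ((η : ℂ))⁻¹ (adTransportW φ fun b => (U b)⁻¹) f -
      RofUk L m n φ η U (c₀ := c₀) (covDivL2K ℂ c₀ ((η : ℂ))⁻¹ (adTransportW φ fun b => (U b)⁻¹) f)‖ ≤ CP * ‖f‖)
    (hPV : ∀ f, ‖covDivL2K ℂ c₀ ((η : ℂ))⁻¹ (adTransportW φ fun b => (V b)⁻¹) f -
      RofUk L m n φ η V (c₀ := c₀) (covDivL2K ℂ c₀ ((η : ℂ))⁻¹ (adTransportW φ fun b => (V b)⁻¹) f)‖ ≤ CP * ‖f‖)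
    (small' : 3 / 4 * pK + (21 + 3 * a) * β ^ 2 + 4 * β * CP + 2 * ρ * CP ^ 2 + βK ≤ γ / 8)
    -- the remaining CONJUGATED two-background letters, lattice form (`δ_R`, `δ_Q`, `δ_K` displayed)
    {δR δQ δK : ℝ} (hδR : 0 ≤ δR) (hδQ : 0 ≤ δQ) (hδK : 0 ≤ δK)
    (tR : ∀ s, ‖(SS ∘ₗ RofUk L m n φ η V (c₀ := c₀) ∘ₗ SSinv) s - (SS ∘ₗ RofUk L m n φ η U (c₀ := c₀) ∘ₗ SSinv) s‖ ≤ δR * ‖s‖)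
    (tQ : ∀ f, ‖QkV f - QkU f‖ ≤ δQ * ‖f‖) (tQ' : ∀ g, ‖QkV' g - QkU' g‖ ≤ δQ * ‖g‖)
    (tK : ∀ f, ‖(S ∘ₗ curvOp φ τ η V ∘ₗ Sinv) f - (S ∘ₗ curvOp φ τ η U ∘ₗ Sinv) f‖ ≤ δK * ‖f‖)
    -- the bond closeness of the two backgrounds and the two remaining UNconjugated letters
    {δ eR eQ : ℝ} (hδ : 0 ≤ δ) (heR : 0 ≤ eR) (heQ : 0 ≤ eQ) (hUV : ∀ b, ‖(U b : 𝔸) - (V b : 𝔸)‖ ≤ δ * η)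
    (uR : ∀ s, ‖RofUk L m n φ η U (c₀ := c₀) s - RofUk L m n φ η V (c₀ := c₀) s‖ ≤ eR * ‖s‖)
    (uQ : ∀ f, ‖(QkW L m n φ U hL α hα1 hU1U hregU (c₀ := c₀) (c₁ := c₁)) f - (QkW L m n φ V hL α hα1 hU1V hregV (c₀ := c₀) (c₁ := c₁)) f‖ ≤ eQ * ‖f‖)
    (y : BondL2K ℂ d (towerP L m (n + 1)) c₀ W) :
    ‖(S ∘ₗ G1k L m n φ η V hL α hα1 hU1V hregV τ (c₀ := c₀) (c₁ := c₁) hposV ∘ₗ Sinv) y -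
        (S ∘ₗ G1k L m n φ η U hL α hα1 hU1U hregU τ (c₀ := c₀) (c₁ := c₁) hposU ∘ₗ Sinv) y‖ ≤
      (((1 + β) * (4 * Real.exp (‖κ‖ * (ℓ * η)) * (Mφ * Mφ') * (d * Real.sqrt d) * δ) + (4 * Real.exp (‖κ‖ * (ℓ * η)) * (Mφ * Mφ') * (d * Real.sqrt d) * δ) * (1 + β) + (4 * Real.exp (‖κ‖ * (ℓ * η)) * (Mφ * Mφ') * (d * Real.sqrt d) * δ) * (4 * Real.exp (‖κ‖ * (ℓ * η)) * (Mφ * Mφ') * (d * Real.sqrt d) * δ)) +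
          ((1 + CP + β) * ((1 + ρ) * (2 * Real.exp (‖κ‖ * (ℓ * η)) * (Mφ * Mφ') * Real.sqrt d * δ) + δR * (1 + CP + β)) + (2 * Real.exp (‖κ‖ * (ℓ * η)) * (Mφ * Mφ') * Real.sqrt d * δ) * ((1 + ρ) * (1 + CP + β)) +
            (2 * Real.exp (‖κ‖ * (ℓ * η)) * (Mφ * Mφ') * Real.sqrt d * δ) * ((1 + ρ) * (2 * Real.exp (‖κ‖ * (ℓ * η)) * (Mφ * Mφ') * Real.sqrt d * δ) + δR * (1 + CP + β))) +
          δK + ((Real.sqrt a + |a| * β) * δQ + δQ * (Real.sqrt a + |a| * β) + |a| * (δQ * δQ))) / min (1 / 4) (γ / 8) *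
        ((1 + (8 * Real.sqrt d * (Mφ * Mφ') * δ + 2 * Mφ * Mφ' * δ * Real.sqrt d + eR * (1 + CP) + Real.sqrt a * eQ)) * (min (1 / 4) (γ / 8))⁻¹) * ‖y‖ := by
  have hMT' : 0 ≤ 2 * Mφ * Mφ' * (δ * η) := by positivity
  have hθ : ∀ b : Bond d (towerP L m (n + 1)), |χ (bpos b) - χ (btgt b)| ≤ ℓ * η := hχ
  have hηn : ‖((η : ℂ))⁻¹‖ * η = 1 := by rw [norm_inv, Complex.norm_real, Real.norm_eq_abs, abs_of_pos hη, inv_mul_cancel₀ hη.ne']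
  have hcn : ‖((η : ℂ))⁻¹‖ * (2 * Mφ * Mφ' * (δ * η)) = 2 * (Mφ * Mφ') * δ := by
    calc ‖((η : ℂ))⁻¹‖ * (2 * Mφ * Mφ' * (δ * η)) = 2 * (Mφ * Mφ') * δ * (‖((η : ℂ))⁻¹‖ * η) := by ring
      _ = 2 * (Mφ * Mφ') * δ := by rw [hηn, mul_one]
  -- the fibre transporter differences (`V` against `U`, and their inverses)
  have hVU : ∀ (b : Bond d (towerP L m (n + 1))) (w : W), ‖adTransportW φ V b w - adTransportW φ U b w‖ ≤ 2 * Mφ * Mφ' * (δ * η) * ‖w‖ := fun b w => by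
    refine (B9Eq373TransporterLipschitzLetters.norm_adTransportW_sub_adTransportW_le φ hφ hφ' hMφ' V U b b (hV b) (hU b) w).trans ?_
    have h := hUV b
    rw [← norm_sub_rev] at h
    have : 2 * Mφ * Mφ' * ‖(V b : 𝔸) - (U b : 𝔸)‖ ≤ 2 * Mφ * Mφ' * (δ * η) := mul_le_mul_of_nonneg_left (by rw [norm_sub_rev]; exact hUV b) (by positivity)
    exact mul_le_mul_of_nonneg_right this (norm_nonneg _)
  have hVUinv : ∀ (b : Bond d (towerP L m (n + 1))) (w : W),
      ‖adTransportW φ (fun b => (V b)⁻¹) b w - adTransportW φ (fun b => (U b)⁻¹) b w‖ ≤ 2 * Mφ * Mφ' * (δ * η) * ‖w‖ := fun b w => by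
    refine (norm_adTransportW_inv_sub_adTransportW_inv_le φ hφ hφ' hMφ' V U b b (hV b) (hU b) w).trans ?_
    have : 2 * Mφ * Mφ' * ‖(V b : 𝔸) - (U b : 𝔸)‖ ≤ 2 * Mφ * Mφ' * (δ * η) := mul_le_mul_of_nonneg_left (by rw [norm_sub_rev]; exact hUV b) (by positivity)
    exact mul_le_mul_of_nonneg_right this (norm_nonneg _)
  have hd : (d : ℝ) ≤ d * Real.sqrt d := by
    rcases Nat.eq_zero_or_pos d with h0 | hpos
    · simp [h0]
    · have h1 : (1 : ℝ) ≤ Real.sqrt d := by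
        rw [show (1 : ℝ) = Real.sqrt 1 by simp]
        exact Real.sqrt_le_sqrt (by exact_mod_cast hpos)
      nlinarith [Nat.cast_nonneg (α := ℝ) d]
  -- the four first-order conjugated letters
  have tB₁ : ∀ f, ‖(SP ∘ₗ covCurlL2K ℂ c₀ ((η : ℂ))⁻¹ (adTransportW φ V) ∘ₗ Sinv) f - (SP ∘ₗ covCurlL2K ℂ c₀ ((η : ℂ))⁻¹ (adTransportW φ U) ∘ₗ Sinv) f‖ ≤
      (4 * Real.exp (‖κ‖ * (ℓ * η)) * (Mφ * Mφ') * (d * Real.sqrt d) * δ) * ‖f‖ := fun f => by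
    simp only [LinearMap.comp_apply]
    refine (norm_mulOp_covCurlL2K_sub_covCurlL2K_le hMT' hVU hθ ((η : ℂ))⁻¹ SP hSP Sinv hSinv f).trans ?_
    have e : 2 * ‖((η : ℂ))⁻¹‖ * Real.exp (‖κ‖ * (ℓ * η)) * (2 * Mφ * Mφ' * (δ * η)) * (d : ℝ) =
        4 * Real.exp (‖κ‖ * (ℓ * η)) * (Mφ * Mφ') * d * δ := by
      calc _ = 2 * Real.exp (‖κ‖ * (ℓ * η)) * (‖((η : ℂ))⁻¹‖ * (2 * Mφ * Mφ' * (δ * η))) * d := by ring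
        _ = _ := by rw [hcn]; ring
    rw [e]
    have : 4 * Real.exp (‖κ‖ * (ℓ * η)) * (Mφ * Mφ') * d * δ ≤ 4 * Real.exp (‖κ‖ * (ℓ * η)) * (Mφ * Mφ') * (d * Real.sqrt d) * δ := by
      have h0 : 0 ≤ 4 * Real.exp (‖κ‖ * (ℓ * η)) * (Mφ * Mφ') := by positivity
      nlinarith [mul_le_mul_of_nonneg_left hd h0]
    exact mul_le_mul_of_nonneg_right this (norm_nonneg _)
  have tB₁' : ∀ p, ‖(S ∘ₗ covCoCurlL2K ℂ c₀ ((η : ℂ))⁻¹ (adTransportW φ fun b => (V b)⁻¹) ∘ₗ SPinv) p -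
      (S ∘ₗ covCoCurlL2K ℂ c₀ ((η : ℂ))⁻¹ (adTransportW φ fun b => (U b)⁻¹) ∘ₗ SPinv) p‖ ≤ (4 * Real.exp (‖κ‖ * (ℓ * η)) * (Mφ * Mφ') * (d * Real.sqrt d) * δ) * ‖p‖ := fun p => by
    simp only [LinearMap.comp_apply]
    refine (norm_mulOp_covCoCurlL2K_sub_covCoCurlL2K_le hMT' hVUinv hθ ((η : ℂ))⁻¹ S hS SPinv hSPinv p).trans_eq ?_
    calc _ = 2 * Real.exp (‖κ‖ * (ℓ * η)) * (‖((η : ℂ))⁻¹‖ * (2 * Mφ * Mφ' * (δ * η))) * (d * Real.sqrt d) * ‖p‖ := by ring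
      _ = _ := by rw [hcn]; ring
  have tB₂ : ∀ f, ‖(SS ∘ₗ covDivL2K ℂ c₀ ((η : ℂ))⁻¹ (adTransportW φ fun b => (V b)⁻¹) ∘ₗ Sinv) f -
      (SS ∘ₗ covDivL2K ℂ c₀ ((η : ℂ))⁻¹ (adTransportW φ fun b => (U b)⁻¹) ∘ₗ Sinv) f‖ ≤ (2 * Real.exp (‖κ‖ * (ℓ * η)) * (Mφ * Mφ') * Real.sqrt d * δ) * ‖f‖ := fun f => by
    simp only [LinearMap.comp_apply]
    refine (norm_mulOp_covDivL2K_sub_covDivL2K_le hMT' hVUinv hθ ((η : ℂ))⁻¹ SS hSS Sinv hSinv f).trans_eq ?_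
    calc _ = Real.exp (‖κ‖ * (ℓ * η)) * (‖((η : ℂ))⁻¹‖ * (2 * Mφ * Mφ' * (δ * η))) * Real.sqrt d * ‖f‖ := by ring
      _ = _ := by rw [hcn]; ring
  have tB₂' : ∀ s, ‖(S ∘ₗ covDerivL2K ℂ c₀ ((η : ℂ))⁻¹ (adTransportW φ V) ∘ₗ SSinv) s - (S ∘ₗ covDerivL2K ℂ c₀ ((η : ℂ))⁻¹ (adTransportW φ U) ∘ₗ SSinv) s‖ ≤
      (2 * Real.exp (‖κ‖ * (ℓ * η)) * (Mφ * Mφ') * Real.sqrt d * δ) * ‖s‖ := fun s => by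
    simp only [LinearMap.comp_apply]
    refine (norm_mulOp_covDerivL2K_sub_covDerivL2K_le hMT' hVU hθ ((η : ℂ))⁻¹ S hS SSinv hSSinv s).trans_eq ?_
    calc _ = Real.exp (‖κ‖ * (ℓ * η)) * (‖((η : ℂ))⁻¹‖ * (2 * Mφ * Mφ' * (δ * η))) * Real.sqrt d * ‖s‖ := by ring
      _ = _ := by rw [hcn]; ring
  exact norm_conjG1k_sub_conjG1k_le_of_closeness L m n φ hφ hφ' hMφ hMφ' hη U V hU hV hRSU hRSV τ hL α hα1 hU1U hregU hU1V hregV a hS hSinv hSP hSPinv hSS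
    hSSinv ha hposU hposV hγ hβ hℓ hρ hρ8 hCP hcoerU hcoerV hKreU hKreV hχ hwin hβCC hβC hβD QkU QkV QkU' QkV' hQfacU hQfacV dQU dQU' dQV dQV' dKU dKV dRU
    dRV hPU hPV small' (by positivity) (by positivity) hδR hδQ hδK tB₁ tB₁' tB₂ tB₂' tR tQ tQ' tK hδ heR heQ hUV uR uQ y

end Literature.MathematicalPhysics.QuantumFieldTheory.Balaban1983to89.B9Eq326ConjugatedDeltaATowerTwoBackgroundsFirstOrder

end
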